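import Literature.AlgebraicGeometry.ComplexMultiplication.EndomorphismFieldHodgeRingDimensions
import Literature.AlgebraicGeometry.ComplexMultiplication.EndomorphismFieldMumfordTateRank
import Literature.AlgebraicGeometry.ComplexMultiplication.EndomorphismFieldWeilTypeCriterion
import Literature.AlgebraicGeometry.Pohlmann1968.WeilTypeCMSubfieldRankBound
import HarnessLib

/-!
# Weil type relative to a subfield of the CM field: degeneracy (Yanai) and — for a SIMPLE pair — exceptional Hodge
# classes on the variety itself (Mumford–Pohlmann; Moonen–Zarhin 2.4), for Shimura's pairs `(A, ι : F →+* End_ℚ(A))`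

Topic `Literature/AlgebraicGeometry/ComplexMultiplication` (family `hodge`, lane `lit-hodgefound`; the ALGEBRAIC
carrier `Motives.AbelianVariety ℂ`).  Junction of the lineage `EndomorphismFieldNondegenerateType` (`A ∼ A_Φ`; `A`
simple ⟺ THE type `Φ = cmTypeOfPair ιF hF` primitive; stable nondegeneracy ⟺ `Φ` nondegenerate for `A` simple),
`EndomorphismFieldHodgeRingDimensions` (Pohlmann's criterion `exists_exceptional_iff` and White's count on the pair),
`EndomorphismFieldMumfordTateRank` (`dim MT(H¹(A)) = Rank(Φ)`) and `EndomorphismFieldWeilTypeCriterion` (van Geemen's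
Weil type `(n, d)` read on THE type) with the tree's TYPE-LEVEL files `Pohlmann1968/WeilTypeCMSubfieldExceptionalClasses`
and `…RankBound` (a CM type BALANCED over a subfield `k ⊂ K` with a complex place is degenerate — Yanai's theorem,
case `a = b` — and, if primitive, every REALISATION `IsCMTypeRealisation Φ A ι θ` carries the weight class of a fibre
as an exceptional Hodge class).  Here everything is said of the PAIR `(A, ι)` — Shimura's / van Geemen's printed
hypothesis «a CM field `F ⊆ End_ℚ(A)` of degree `2 dim A`» (resp. «`K ⊂ End(X)_ℚ`, `t(x) ∼ diag(x,…,x,x̄,…,x̄)`»), which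
need not be principal and carries no chosen `θ`.

PRINTED STATEMENTS.  B. van Geemen, *An introduction to the Hodge conjecture for abelian varieties* (LNM 1594, 1994),
4.7 («Weil considers abelian varieties `X` of dimension `2n` such that `K ⊂ End(X)_ℚ` … for all `x ∈ K` … `t(x)` has
`n` eigenvalues `x` and `n` eigenvalues `x̄`»), 4.9 (Definition), **Thm. 4.5** («There exist simple four dimensional
abelian varieties with `B² ≠ D²`», Mumford's CM examples, Pohlmann 1968 §3); B. Moonen, Yu. Zarhin, Duke Math. J. 77
(1995) **Thm. 2.4** with (2.7) (a simple abelian fourfold supports exceptional classes iff `End⁰` contains an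
imaginary quadratic field acting with multiplicities `(2,2)`); B. B. Gordon, *A survey of the Hodge conjecture for
abelian varieties* (1999), **5.13 (ii)** («`dim Hdg²(A) = 8`, and `dim Div²(A) = 6`, and `Hdg²(A) = Div²(A) + W(A)`»),
9.2.2, **§9.4.3 Theorem [B.140]** (H. Yanai, *On degenerate CM-types*, J. Number Theory 49 (1994): «if `a = b` then
`d + 1 − rank S ≥ d₁` … the CM-type `(K, S)` is degenerate»), Thm. 6.4 (Hazama).

WHAT IS PROVED (theorems only; no definition, no named fact; `F` a CM field, `ιF : F →+* A.endAlgebra`,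
`hF : [F:ℚ] = 2 dim A`).
§1 ANY SUBFIELD `j : k →+* F` over which THE type is balanced («`k` acts with equal multiplicities»), with a non-real
embedding `τ₀`:
* `isPrimitive_cmTypeOfPair_of_isSimple`; **`not_isStablyNondegenerate_of_fibres_balanced`** (for `A` SIMPLE some power
  has `B ≠ D`; `exists_powSucc_not_isDivisorGenerated_of_fibres_balanced`);
* **`exists_exceptional_of_fibres_balanced`** — for `A` SIMPLE, a rational `(m,m)`-class ON `A`, `2m = [F : k]`, outside
  `Dᵐ(A) ⊗ ℂ` (the Mumford–Pohlmann mechanism); **`two_le_finrank_hodgeClassSpan_sub_finrank_divisorClassesSpan`**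
  (`dim Bᵐ(A) − dim Dᵐ(A) ≥ 2`);
* **`mtRank_hodge_one_add_le_of_fibres_balanced`** — Yanai's bound in Mumford–Tate form, NO simplicity:
  `dim MT(H¹(A)) + [k:ℚ]/2 ≤ dim A + 1` for `k` admitting a CM type.
§2 (private bookkeeping for `k = ℚ(α)`, `α² = -d`, `d > 0`: `[ℚ(α):ℚ] = 2`, the fibres of `Hom(F,ℂ) → Hom(ℚ(α),ℂ)` are
`{φ | φ(α) = ± i√d}` of size `[F:ℚ]/2`, no embedding of `ℚ(α)` is real).
§3 VAN GEEMEN'S WEIL TYPE `(n, d)` (`HodgeTheory.IsWeilType A u n d`, `1 ⊗ u = ι(α)`):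
* `fibres_balanced_of_card_eq`, `ncard_fibre_inter_eq` — Weil type read on THE type (`isWeilType_iff`) makes THE type
  balanced over `ℚ(α)` with `n` members over each embedding;
* **`exists_exceptional_of_isWeilType`** — A SIMPLE PAIR OF WEIL TYPE `(n, d)` CARRIES A RATIONAL `(n,n)`-CLASS OUTSIDE
  `Dⁿ(A) ⊗ ℂ` (van Geemen Thm. 4.5 / Mumford–Pohlmann for every simple CM pair of Weil type; `n = 2`: the CM case of
  Moonen–Zarhin 2.4 (ii) ⇐); **`two_le_finrank_hodgeClassSpan_sub_finrank_divisorClassesSpan_of_isWeilType`**;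
* `not_isNondegenerate_cmTypeOfPair_of_isWeilType` (no simplicity: THE type is degenerate),
  `not_isStablyNondegenerate_of_isWeilType`, **`mtRank_hodge_one_le_dim_of_isWeilType`** (`dim MT(H¹(A)) ≤ dim A`, no
  simplicity).

No `sorry`; axioms `propext`, `Classical.choice`, `Quot.sound`.

## References
* [vanGeemen1994HodgeAV] B. van Geemen, *An introduction to the Hodge conjecture for abelian varieties*, LNM 1594
  (1994), 4.5, 4.7, 4.9.
* [MoonenZarhin1995Duke] B. Moonen, Yu. Zarhin, *Hodge classes and Tate classes on simple abelian fourfolds*, Duke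
  Math. J. 77 (1995), Thm. 2.4, (2.7).
* [Gordon1999HodgeAVSurvey] B. B. Gordon, *A survey of the Hodge conjecture for abelian varieties* (1999), 5.13, Thm. 6.4,
  9.1, 9.2.2, §9.4.3 (Theorem [B.140] = Yanai 1994).
* [Pohlmann1968] H. Pohlmann, *Algebraic cycles on abelian varieties of complex multiplication type*, Ann. of Math. 88
  (1968), Thm. 1, §3.
* [Shimura1998] G. Shimura, *Abelian Varieties with Complex Multiplication and Modular Functions* (1998), §8.2 Prop. 26.
-/

noncomputable section

open CategoryTheory NumberField Module Polynomial

namespace Literature.AlgebraicGeometry.ComplexMultiplication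

open scoped Manifold Classical nonZeroDivisors IntermediateField
open Literature.AlgebraicGeometry.Motives Literature.AlgebraicGeometry.HodgeTheory
open Literature.AlgebraicGeometry.Pohlmann1968 (IsNondegenerate cmTypeRank cmTypeRank_le isNondegenerate_iff
  pohlmannSets pohlmannDivisorSets)
open Literature.AlgebraicGeometry.VanGeemen1994 (hodgeClassSpan)
open Literature.Barriers.HodgeConjecture (divisorClassesSpan)
open Literature.NumberTheory.ComplexMultiplication

namespace EndFieldFullDegree

/-! ### §1 Any subfield `k ⊂ F` over which THE type is balanced (Yanai's `a = b`) -/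

section Subfield

variable {F : Type} [Field F] [NumberField F] [IsCMField F] {A : AbelianVariety ℂ}
  (ιF : F →+* A.endAlgebra) (hF : finrank ℚ F = 2 * A.dim)
  {k : Type} [Field k] (j : k →+* F)

include hF in
/-- `A` simple ⟹ THE type is primitive in Shimura's `Aut(ℂ)`-form at every base embedding (
`isSimple_iff_primitive_cmTypeOfPair` with `isPrimitive_ringEquiv_complex_iff`). [cite: Shimura1998, §8.2 Prop. 26] -/
theorem isPrimitive_cmTypeOfPair_of_isSimple (hS : AbelianVariety.IsSimple A) (φ₀ : F →+* ℂ) :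
    IsPrimitive (ℂ ≃+* ℂ) (cmTypeOfPair ιF hF).1 φ₀ :=
  (isPrimitive_ringEquiv_complex_iff (cmTypeOfPair ιF hF) φ₀).2 ((isSimple_iff_primitive_cmTypeOfPair ιF hF).1 hS)

include hF in
/-- **Yanai's theorem (case `a = b`) for a SIMPLE pair: if THE type of `(A, ι)` is balanced over a subfield
`k ⊂ F` having a complex place, then `A` is NOT stably nondegenerate** — `B(Aⁿ) ≠ D(Aⁿ)` for some power (THE type
is degenerate, `Pohlmann1968.not_isNondegenerate_of_fibres_balanced`; for `A` simple stable nondegeneracy is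
nondegeneracy of THE type, `EndomorphismFieldNondegenerateType`).  Simplicity is needed: a type INDUCED from a
proper CM subfield can be balanced over another subfield while `A ∼ Bʰ` is stably nondegenerate.
[cite: Gordon1999HodgeAVSurvey, §9.4.3 (Theorem [B.140], Yanai 1994) and Thm. 6.4] -/
theorem not_isStablyNondegenerate_of_fibres_balanced (hS : AbelianVariety.IsSimple A)
    (hW : ∀ τ : k →+* ℂ, {φ : F →+* ℂ | φ.comp j = τ ∧ φ ∈ (cmTypeOfPair ιF hF).1}.ncard =
      {φ : F →+* ℂ | φ.comp j = τ ∧ φ ∉ (cmTypeOfPair ιF hF).1}.ncard)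
    {τ₀ : k →+* ℂ} (hτ₀ : ComplexEmbedding.conjugate τ₀ ≠ τ₀) : ¬ IsStablyNondegenerate A := fun h =>
  Pohlmann1968.not_isNondegenerate_of_fibres_balanced j hW hτ₀
    ((isStablyNondegenerate_iff_isNondegenerate_cmTypeOfPair_of_isSimple ιF hF hS).1 h)

include ιF hF in
/-- … i.e. **some power `A^{N+1}` carries a Hodge class that is not a polynomial in divisor classes.**
[cite: Gordon1999HodgeAVSurvey, §9.4.3 and Thm. 6.4] -/
theorem exists_powSucc_not_isDivisorGenerated_of_fibres_balanced (hS : AbelianVariety.IsSimple A)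
    (hW : ∀ τ : k →+* ℂ, {φ : F →+* ℂ | φ.comp j = τ ∧ φ ∈ (cmTypeOfPair ιF hF).1}.ncard =
      {φ : F →+* ℂ | φ.comp j = τ ∧ φ ∉ (cmTypeOfPair ιF hF).1}.ncard)
    {τ₀ : k →+* ℂ} (hτ₀ : ComplexEmbedding.conjugate τ₀ ≠ τ₀) : ∃ N : ℕ, ¬ IsDivisorGenerated (A.powSucc N) := by
  simpa only [IsStablyNondegenerate, not_forall] using not_isStablyNondegenerate_of_fibres_balanced ιF hF j hS hW hτ₀

include hF in
/-- **Mumford–Pohlmann mechanism for the pair: a SIMPLE `A` with a CM field `F ⊆ End_ℚ(A)` of degree `2 dim A`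
whose type is balanced over a subfield `k ⊂ F` with a non-real embedding `τ₀` carries a rational class of Hodge
type `(m, m)` — `2m = |Δ_{τ₀}| = [F : k]` — OUTSIDE `Dᵐ(A) ⊗ ℂ`** (the weight class of the fibre `Δ_{τ₀}`, a Weil class
of `(A, k)`): Pohlmann's criterion on the pair (`EndFieldFullDegree.exists_exceptional_iff`) and the tree's
`fibre_mem_pohlmannSets_diff` (primitive: `isSimple_iff_primitive_cmTypeOfPair`).
[cite: Gordon1999HodgeAVSurvey, 5.13 (ii) and 9.2.2] [cite: vanGeemen1994HodgeAV, Thm. 4.5 and 4.7]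
[cite: Pohlmann1968, Thm. 1 and §3] -/
theorem exists_exceptional_of_fibres_balanced (hS : AbelianVariety.IsSimple A)
    (hW : ∀ τ : k →+* ℂ, {φ : F →+* ℂ | φ.comp j = τ ∧ φ ∈ (cmTypeOfPair ιF hF).1}.ncard =
      {φ : F →+* ℂ | φ.comp j = τ ∧ φ ∉ (cmTypeOfPair ιF hF).1}.ncard)
    {τ₀ : k →+* ℂ} (hτ₀ : ComplexEmbedding.conjugate τ₀ ≠ τ₀) :
    ∃ c : complexBetti A.X (2 * {φ : F →+* ℂ | φ.comp j = τ₀ ∧ φ ∈ (cmTypeOfPair ιF hF).1}.ncard),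
      IsRationalClass c ∧
      IsOfHodgeType A.dim A.X (2 * {φ : F →+* ℂ | φ.comp j = τ₀ ∧ φ ∈ (cmTypeOfPair ιF hF).1}.ncard)
        {φ : F →+* ℂ | φ.comp j = τ₀ ∧ φ ∈ (cmTypeOfPair ιF hF).1}.ncard
        {φ : F →+* ℂ | φ.comp j = τ₀ ∧ φ ∈ (cmTypeOfPair ιF hF).1}.ncard c ∧
      c ∉ divisorClassesSpan A.X A.dim {φ : F →+* ℂ | φ.comp j = τ₀ ∧ φ ∈ (cmTypeOfPair ιF hF).1}.ncard := by
  obtain ⟨φ₀⟩ : Nonempty (F →+* ℂ) := inferInstance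
  exact (exists_exceptional_iff ιF hF _).2
    ⟨_, Pohlmann1968.fibre_mem_pohlmannSets_diff j φ₀ (isPrimitive_cmTypeOfPair_of_isSimple ιF hF hS φ₀) hW hτ₀⟩

include hF in
/-- **At least two independent exceptional lines: `dim Bᵐ(A) − dim Dᵐ(A) ≥ 2`** in the degree `2m = [F : k]`, for a
simple pair balanced over `k` with a non-real place (the fibres `Δ_{τ₀} ≠ Δ_{τ̄₀}`; `= 2` in Gordon 5.13 (ii)
«`dim Hdg²(A) = 8`, and `dim Div²(A) = 6`»). [cite: Gordon1999HodgeAVSurvey, 5.13 (ii) and 9.2.2] -/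
theorem two_le_finrank_hodgeClassSpan_sub_finrank_divisorClassesSpan (hS : AbelianVariety.IsSimple A)
    (hW : ∀ τ : k →+* ℂ, {φ : F →+* ℂ | φ.comp j = τ ∧ φ ∈ (cmTypeOfPair ιF hF).1}.ncard =
      {φ : F →+* ℂ | φ.comp j = τ ∧ φ ∉ (cmTypeOfPair ιF hF).1}.ncard)
    {τ₀ : k →+* ℂ} (hτ₀ : ComplexEmbedding.conjugate τ₀ ≠ τ₀) :
    2 ≤ Module.finrank ℂ ↥(hodgeClassSpan A.dim A.X {φ : F →+* ℂ | φ.comp j = τ₀ ∧ φ ∈ (cmTypeOfPair ιF hF).1}.ncard) -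
      Module.finrank ℂ ↥(divisorClassesSpan A.X A.dim {φ : F →+* ℂ | φ.comp j = τ₀ ∧ φ ∈ (cmTypeOfPair ιF hF).1}.ncard) := by
  obtain ⟨φ₀⟩ : Nonempty (F →+* ℂ) := inferInstance
  obtain ⟨ι', θ', hB⟩ := CMTorusRealisation.exists_isCMTypeRealisation_varietyOfIdeal (cmTypeOfPair ιF hF)
    (1 : (FractionalIdeal (𝓞 F)⁰ F)ˣ)
  rw [finrank_hodgeClassSpan_sub_finrank_divisorClassesSpan ιF hF,
    ← Pohlmann1968.finrank_hodgeClassSpan_sub_finrank_divisorClassesSpan hB]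
  exact Pohlmann1968.two_le_finrank_hodgeClassSpan_sub_finrank_divisorClassesSpan j φ₀
    (isPrimitive_cmTypeOfPair_of_isSimple ιF hF hS φ₀) hW hτ₀ hB

variable [HodgeTensorFacts.{0, 0}] {n : ℕ} (hX : IsSmoothProjective n A.X)

include hF in
/-- **Yanai's bound `d + 1 − rank S ≥ d₁` in Mumford–Tate form, for the pair (no simplicity)**: if THE type of
`(A, ι)` is balanced over a subfield `k ⊂ F` admitting a CM type (`[k:ℚ] = 2d₁`), then
`dim MT(H¹(A)) + d₁ ≤ dim A + 1` (`mtRank_hodge_one_eq_cmTypeRank`: `dim MT = Rank(Φ)`; the tree's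
`cmTypeRank_add_finrank_div_two_le_of_fibres_balanced`). [cite: Gordon1999HodgeAVSurvey, §9.4.3 (Theorem [B.140], Yanai 1994) and 9.1] -/
theorem mtRank_hodge_one_add_le_of_fibres_balanced [NumberField k]
    (hW : ∀ τ : k →+* ℂ, {φ : F →+* ℂ | φ.comp j = τ ∧ φ ∈ (cmTypeOfPair ιF hF).1}.ncard =
      {φ : F →+* ℂ | φ.comp j = τ ∧ φ ∉ (cmTypeOfPair ιF hF).1}.ncard)
    (Ψ : CMType k) :
    haveI := BettiUniverse.finite hX 1
    (BettiUniverse.hodge exists_isReal_hodgeModel_holds hX 1).mtRank + finrank ℚ k / 2 ≤ A.dim + 1 := by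
  haveI := BettiUniverse.finite hX 1
  have h := Pohlmann1968.cmTypeRank_add_finrank_div_two_le_of_fibres_balanced j hW Ψ
  have hr := mtRank_hodge_one_eq_cmTypeRank ιF hF hX
  omega

end Subfield

/-! ### §2 The imaginary quadratic subfield `ℚ(α) ⊂ F`, `α² = -d`: van Geemen's Weil type `(n, d)` -/

section QuadraticSubfield

variable {F : Type} [Field F] [NumberField F] {α : F} {d : ℕ}

/-- A complex square root of `-d` is `± i√d`. [folklore] -/
private theorem eq_or_eq_neg_of_sq_eq_neg {z : ℂ} (hz : z ^ 2 = -(d : ℂ)) :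
    z = Complex.I * (Real.sqrt d : ℂ) ∨ z = -(Complex.I * (Real.sqrt d : ℂ)) := by
  have hw : (Complex.I * (Real.sqrt d : ℂ)) ^ 2 = -(d : ℂ) := by
    rw [mul_pow, Complex.I_sq, ← Complex.ofReal_pow, Real.sq_sqrt (Nat.cast_nonneg _), Complex.ofReal_natCast]
    ring
  have h0 : (z - Complex.I * (Real.sqrt d : ℂ)) * (z + Complex.I * (Real.sqrt d : ℂ)) = 0 := by
    rw [show (z - Complex.I * (Real.sqrt d : ℂ)) * (z + Complex.I * (Real.sqrt d : ℂ)) =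
      z ^ 2 - (Complex.I * (Real.sqrt d : ℂ)) ^ 2 by ring, hz, hw, sub_self]
  rcases mul_eq_zero.1 h0 with h | h
  · exact Or.inl (sub_eq_zero.1 h)
  · exact Or.inr (eq_neg_of_add_eq_zero_left h)

/-- `i√d ≠ -i√d` for `d > 0`. [folklore] -/
private theorem I_mul_sqrt_ne_neg (hd : 0 < d) :
    Complex.I * (Real.sqrt d : ℂ) ≠ -(Complex.I * (Real.sqrt d : ℂ)) := by
  intro h
  have h2 : (2 : ℂ) * (Complex.I * (Real.sqrt d : ℂ)) = 0 := by rw [two_mul]; nth_rw 2 [h]; exact add_neg_cancel _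
  rcases mul_eq_zero.1 h2 with h | h
  · exact two_ne_zero h
  · rcases mul_eq_zero.1 h with h | h
    · exact Complex.I_ne_zero h
    · exact (Real.sqrt_ne_zero'.2 (Nat.cast_pos.2 hd)) (Complex.ofReal_eq_zero.1 h)

/-- Every embedding sends `α` (`α² = -d`) to `± i√d`. [folklore] -/
private theorem apply_eq_or (hα : α ^ 2 = -(d : F)) (φ : F →+* ℂ) :
    φ α = Complex.I * (Real.sqrt d : ℂ) ∨ φ α = -(Complex.I * (Real.sqrt d : ℂ)) :=
  eq_or_eq_neg_of_sq_eq_neg (by rw [← map_pow, hα, map_neg, map_natCast])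

/-- **`[ℚ(α) : ℚ] = 2`** for `α² = -d`, `d > 0` (`X² + d` has no rational root). [folklore] -/
private theorem finrank_adjoin_eq_two (hd : 0 < d) (hα : α ^ 2 = -(d : F)) : finrank ℚ ℚ⟮α⟯ = 2 := by
  have hint : IsIntegral ℚ α := IsIntegral.of_finite ℚ α
  rw [IntermediateField.adjoin.finrank hint]
  have haeval : aeval α (X ^ 2 + C (d : ℚ) : ℚ[X]) = 0 := by
    simp [hα]
  have hle : (minpoly ℚ α).natDegree ≤ 2 := by
    have h := natDegree_le_of_dvd (minpoly.dvd ℚ α haeval) (X_pow_add_C_ne_zero two_pos _)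
    rwa [natDegree_X_pow_add_C] at h
  have hne : α ∉ (algebraMap ℚ F).range := by
    rintro ⟨q, hq⟩
    have hq2 : (q : ℚ) ^ 2 = -(d : ℚ) := by
      apply (algebraMap ℚ F).injective
      rw [map_pow, hq, hα, map_neg, map_natCast]
    nlinarith [sq_nonneg q, (Nat.cast_pos.2 hd : (0 : ℚ) < d)]
  have hge : 2 ≤ (minpoly ℚ α).natDegree := (minpoly.two_le_natDegree_iff hint).2 hne
  omega

/-- `[F : ℚ(α)] = [F : ℚ] / 2`. [folklore] -/
private theorem two_mul_finrank_adjoin (hd : 0 < d) (hα : α ^ 2 = -(d : F)) :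
    2 * finrank ℚ⟮α⟯ F = finrank ℚ F := by
  rw [← finrank_adjoin_eq_two hd hα, Module.finrank_mul_finrank]

/-- `gen² = -d` in `ℚ(α)`. [folklore] -/
private theorem gen_sq (hα : α ^ 2 = -(d : F)) :
    (IntermediateField.AdjoinSimple.gen ℚ α) ^ 2 = -(d : ℚ⟮α⟯) := by
  apply (algebraMap ℚ⟮α⟯ F).injective
  rw [map_pow, IntermediateField.AdjoinSimple.algebraMap_gen, hα, map_neg, map_natCast]

/-- **The fibre of `Hom(F, ℂ) → Hom(ℚ(α), ℂ)` over `τ` is `{φ | φ(α) = τ(α)}`** (a homomorphism out of `ℚ(α)` is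
determined by its value at `α`: power basis). [folklore] -/
private theorem comp_algebraMap_eq_iff (τ : ℚ⟮α⟯ →+* ℂ) (φ : F →+* ℂ) :
    φ.comp (algebraMap ℚ⟮α⟯ F) = τ ↔ φ α = τ (IntermediateField.AdjoinSimple.gen ℚ α) := by
  constructor
  · intro h
    rw [← h, RingHom.comp_apply, IntermediateField.AdjoinSimple.algebraMap_gen]
  · intro h
    have hint : IsIntegral ℚ α := IsIntegral.of_finite ℚ α
    let f : ℚ⟮α⟯ →ₐ[ℚ] ℂ :=
      { toRingHom := φ.comp (algebraMap ℚ⟮α⟯ F), commutes' := fun q => by simp }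
    let g : ℚ⟮α⟯ →ₐ[ℚ] ℂ := { toRingHom := τ, commutes' := fun q => by simp }
    have hfg : f = g := by
      refine PowerBasis.algHom_ext (IntermediateField.adjoin.powerBasis hint) ?_
      rw [IntermediateField.adjoin.powerBasis_gen]
      change φ (algebraMap ℚ⟮α⟯ F (IntermediateField.AdjoinSimple.gen ℚ α)) = τ _
      rw [IntermediateField.AdjoinSimple.algebraMap_gen, h]
    exact RingHom.ext fun x => AlgHom.congr_fun hfg x

/-- The value `τ(α)` of an embedding of `ℚ(α)` is `± i√d`. [folklore] -/
private theorem apply_gen_eq_or (hα : α ^ 2 = -(d : F)) (τ : ℚ⟮α⟯ →+* ℂ) :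
    τ (IntermediateField.AdjoinSimple.gen ℚ α) = Complex.I * (Real.sqrt d : ℂ) ∨
      τ (IntermediateField.AdjoinSimple.gen ℚ α) = -(Complex.I * (Real.sqrt d : ℂ)) :=
  eq_or_eq_neg_of_sq_eq_neg (by rw [← map_pow, gen_sq hα, map_neg, map_natCast])

/-- No embedding of `ℚ(α)` is real (`d > 0`). [folklore] -/
private theorem conjugate_ne (hd : 0 < d) (hα : α ^ 2 = -(d : F)) (τ : ℚ⟮α⟯ →+* ℂ) :
    ComplexEmbedding.conjugate τ ≠ τ := by
  intro h
  have hc := RingHom.congr_fun h (IntermediateField.AdjoinSimple.gen ℚ α)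
  rw [ComplexEmbedding.conjugate_coe_eq] at hc
  have hconj : starRingEnd ℂ (Complex.I * (Real.sqrt d : ℂ)) = -(Complex.I * (Real.sqrt d : ℂ)) := by
    rw [map_mul, Complex.conj_I, Complex.conj_ofReal, neg_mul]
  rcases apply_gen_eq_or hα τ with h1 | h1
  · rw [h1, hconj] at hc
    exact I_mul_sqrt_ne_neg hd hc.symm
  · rw [h1, map_neg, hconj, neg_neg] at hc
    exact I_mul_sqrt_ne_neg hd hc

/-- **The fibre over `τ` has `[F : ℚ(α)] = [F:ℚ]/2` elements**: `#{φ | φ(α) = τ(α)} · 2 = [F : ℚ]`. [folklore] -/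
private theorem two_mul_card_filter_apply_eq (hd : 0 < d) (hα : α ^ 2 = -(d : F)) (τ : ℚ⟮α⟯ →+* ℂ) :
    2 * (Finset.univ.filter fun φ : F →+* ℂ => φ α = τ (IntermediateField.AdjoinSimple.gen ℚ α)).card =
      finrank ℚ F := by
  have h := Pohlmann1968.card_fibre_eq_finrank (K := F) (k := ℚ⟮α⟯) τ
  rw [Finset.filter_congr (fun φ _ => comp_algebraMap_eq_iff τ φ)] at h
  rw [h, two_mul_finrank_adjoin hd hα]

end QuadraticSubfield

/-! ### §3 THE type of a pair of Weil type `(n, d)` is balanced over `ℚ(α)`; exceptional classes on a simple pair of Weil type -/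

section WeilType

variable {F : Type} [Field F] [NumberField F] [IsCMField F] {A : AbelianVariety ℂ}
  (ιF : F →+* A.endAlgebra) (hF : finrank ℚ F = 2 * A.dim) {α : F} {d n : ℕ}

omit [IsCMField F] in
/-- **Weil type `(n, d)` read on THE type ⟹ THE type is balanced over `ℚ(α)`**: if `dim A = 2n`, `α² = -d`, `d > 0`
and exactly `n` members of `Φ = cmTypeOfPair ι hF` send `α` to `i√d` (van Geemen 4.9, the count of `EndomorphismFieldWeilTypeCriterion.isWeilType_iff`), then
over each of the two embeddings `τ` of `k = ℚ(α)` exactly half of the `2n` extensions of `τ` to `F` lie in `Φ`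
(«`k` acts with multiplicities `(n, n)`»). [cite: vanGeemen1994HodgeAV, 4.7 and 4.9] [cite: MoonenZarhin1995Duke, Thm. 2.4 and (2.7)] -/
theorem fibres_balanced_of_card_eq (hd : 0 < d) (hα : α ^ 2 = -(d : F)) (hdim : A.dim = 2 * n)
    (hcard : Fintype.card {σ : (cmTypeOfPair ιF hF).1 // σ.1 α = Complex.I * (Real.sqrt d : ℂ)} = n)
    (τ : ℚ⟮α⟯ →+* ℂ) :
    {φ : F →+* ℂ | φ.comp (algebraMap ℚ⟮α⟯ F) = τ ∧ φ ∈ (cmTypeOfPair ιF hF).1}.ncard =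
      {φ : F →+* ℂ | φ.comp (algebraMap ℚ⟮α⟯ F) = τ ∧ φ ∉ (cmTypeOfPair ιF hF).1}.ncard := by
  -- rewrite both sides as cardinalities of filters of the fibre `{φ | φ α = τ(α)}`
  have hfib : ∀ φ : F →+* ℂ, φ.comp (algebraMap ℚ⟮α⟯ F) = τ ↔
      φ α = τ (IntermediateField.AdjoinSimple.gen ℚ α) := comp_algebraMap_eq_iff τ
  rw [Set.ncard_eq_toFinset_card', Set.ncard_eq_toFinset_card', Set.toFinset_setOf, Set.toFinset_setOf,
    Finset.filter_congr (fun φ _ => and_congr_left' (hfib φ)),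
    Finset.filter_congr (s := Finset.univ)
      (p := fun φ => φ.comp (algebraMap ℚ⟮α⟯ F) = τ ∧ φ ∉ (cmTypeOfPair ιF hF).1)
      (fun φ _ => and_congr_left' (hfib φ))]
  -- the fibre has `2n` elements
  have hP : (Finset.univ.filter fun φ : F →+* ℂ =>
      φ α = τ (IntermediateField.AdjoinSimple.gen ℚ α)).card = 2 * n := by
    have h := two_mul_card_filter_apply_eq hd hα τ
    rw [hF, hdim] at h
    omega
  -- split of the fibre by membership in `Φ`
  have hsplit := Finset.card_filter_add_card_filter_not
    (s := Finset.univ.filter fun φ : F →+* ℂ => φ α = τ (IntermediateField.AdjoinSimple.gen ℚ α))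
    (fun φ => φ ∈ (cmTypeOfPair ιF hF).1)
  rw [Finset.filter_filter, Finset.filter_filter, hP] at hsplit
  -- members of `Φ` sending `α` to `i√d`: exactly `n`
  have hin₀ : (Finset.univ.filter fun φ : F →+* ℂ =>
      φ α = Complex.I * (Real.sqrt d : ℂ) ∧ φ ∈ (cmTypeOfPair ιF hF).1).card = n := by
    rw [← hcard, Fintype.card_congr (Equiv.subtypeSubtypeEquivSubtypeInter
      (fun φ : F →+* ℂ => φ ∈ (cmTypeOfPair ιF hF).1) (fun φ => φ α = Complex.I * (Real.sqrt d : ℂ))),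
      Fintype.card_subtype]
    exact congrArg Finset.card (Finset.filter_congr fun φ _ => and_comm)
  -- `|Φ| = 2n`
  have hΦcard : (cmTypeOfPair ιF hF).1.toFinset.card = 2 * n := by
    have h := (isShimuraCMType_cmTypeOfPair ιF hF).two_mul_ncard
    rw [Set.ncard_eq_toFinset_card', hF, hdim] at h
    omega
  -- members of `Φ` sending `α` to `-i√d`: the other `n`
  have hin₁ : (Finset.univ.filter fun φ : F →+* ℂ =>
      φ α = -(Complex.I * (Real.sqrt d : ℂ)) ∧ φ ∈ (cmTypeOfPair ιF hF).1).card = n := by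
    have hs := Finset.card_filter_add_card_filter_not (s := (cmTypeOfPair ιF hF).1.toFinset)
      (fun φ : F →+* ℂ => φ α = Complex.I * (Real.sqrt d : ℂ))
    have h1 : ((cmTypeOfPair ιF hF).1.toFinset.filter fun φ : F →+* ℂ => φ α = Complex.I * (Real.sqrt d : ℂ)) =
        Finset.univ.filter fun φ : F →+* ℂ =>
          φ α = Complex.I * (Real.sqrt d : ℂ) ∧ φ ∈ (cmTypeOfPair ιF hF).1 := by
      ext φ; simp [and_comm]
    have h2 : ((cmTypeOfPair ιF hF).1.toFinset.filter fun φ : F →+* ℂ =>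
          ¬ φ α = Complex.I * (Real.sqrt d : ℂ)) =
        Finset.univ.filter fun φ : F →+* ℂ =>
          φ α = -(Complex.I * (Real.sqrt d : ℂ)) ∧ φ ∈ (cmTypeOfPair ιF hF).1 := by
      ext φ
      simp only [Finset.mem_filter, Set.mem_toFinset, Finset.mem_univ, true_and]
      constructor
      · rintro ⟨hφ, hne⟩
        exact ⟨(apply_eq_or hα φ).resolve_left hne, hφ⟩
      · rintro ⟨heq, hφ⟩
        exact ⟨hφ, fun h => I_mul_sqrt_ne_neg hd (h.symm.trans heq)⟩
    rw [h1, h2, hin₀, hΦcard] at hs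
    omega
  -- conclude in the two cases `τ(α) = ± i√d`
  rcases apply_gen_eq_or hα τ with hw | hw
  · rw [hw] at hsplit ⊢
    omega
  · rw [hw] at hsplit ⊢
    omega

omit [IsCMField F] in
/-- The number of members of THE type over the embedding `τ` of `ℚ(α)` is `n`. [cite: vanGeemen1994HodgeAV, 4.9] -/
theorem ncard_fibre_inter_eq (hd : 0 < d) (hα : α ^ 2 = -(d : F)) (hdim : A.dim = 2 * n)
    (hcard : Fintype.card {σ : (cmTypeOfPair ιF hF).1 // σ.1 α = Complex.I * (Real.sqrt d : ℂ)} = n)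
    (τ : ℚ⟮α⟯ →+* ℂ) :
    {φ : F →+* ℂ | φ.comp (algebraMap ℚ⟮α⟯ F) = τ ∧ φ ∈ (cmTypeOfPair ιF hF).1}.ncard = n := by
  have hbal := fibres_balanced_of_card_eq ιF hF hd hα hdim hcard τ
  -- in + out = |fibre| = 2n
  have hfib : ∀ φ : F →+* ℂ, φ.comp (algebraMap ℚ⟮α⟯ F) = τ ↔
      φ α = τ (IntermediateField.AdjoinSimple.gen ℚ α) := comp_algebraMap_eq_iff τ
  have hP : (Finset.univ.filter fun φ : F →+* ℂ => φ.comp (algebraMap ℚ⟮α⟯ F) = τ).card = 2 * n := by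
    have h := two_mul_card_filter_apply_eq hd hα τ
    rw [← Finset.filter_congr (fun φ _ => hfib φ), hF, hdim] at h
    omega
  have hsplit := Finset.card_filter_add_card_filter_not
    (s := Finset.univ.filter fun φ : F →+* ℂ => φ.comp (algebraMap ℚ⟮α⟯ F) = τ)
    (fun φ => φ ∈ (cmTypeOfPair ιF hF).1)
  rw [Finset.filter_filter, Finset.filter_filter, hP] at hsplit
  rw [Set.ncard_eq_toFinset_card', Set.ncard_eq_toFinset_card', Set.toFinset_setOf, Set.toFinset_setOf] at hbal
  rw [Set.ncard_eq_toFinset_card', Set.toFinset_setOf]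
  omega

variable {u : End A}

include hF in
/-- **A SIMPLE pair of Weil type carries exceptional Hodge classes in the middle degree: `Bⁿ(A) ⊗ ℂ ⊄ Dⁿ(A) ⊗ ℂ`.**
For `A` simple with a CM field `F ⊆ End_ℚ(A)` of degree `2 dim A` and `u ∈ End(A)`, `1 ⊗ u = ι(α)`, such that
`(A, u)` is of Weil type `(n, d)` (van Geemen 4.9: `dim A = 2n`, `u² = -d`, `i√d` an eigenvalue of `u^*` on `H^{1,0}`
of multiplicity `n`), there is a rational class of Hodge type `(n, n)` on `A` that is not in `Dⁿ(A) ⊗ ℂ` — Mumford's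
examples (Pohlmann §3, van Geemen Thm. 4.5 «There exist simple four dimensional abelian varieties with `B² ≠ D²`»)
as a theorem about all simple CM pairs of Weil type; for `n = 2` the direction ⇐ of Moonen–Zarhin's Thm. 2.4 (ii) in
the CM case («If `K` does contain an imaginary quadratic field `F` acting on `A` with multiplicities `(2,2)`, then …
`Hdg²(A) = Div²(A) + W(A)`», `W ⊄ Div²`). [cite: vanGeemen1994HodgeAV, Thm. 4.5, 4.7 and 4.9]
[cite: MoonenZarhin1995Duke, Thm. 2.4] [cite: Gordon1999HodgeAVSurvey, 5.13 (ii)] [cite: Pohlmann1968, Thm. 1 and §3] -/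
theorem exists_exceptional_of_isWeilType (hS : AbelianVariety.IsSimple A)
    (hu : AbelianVariety.endAlgebra.of A u = ιF α) (h : HodgeTheory.IsWeilType A u n d) :
    ∃ c : complexBetti A.X (2 * n), IsRationalClass c ∧ IsOfHodgeType A.dim A.X (2 * n) n n c ∧
      c ∉ divisorClassesSpan A.X A.dim n := by
  obtain ⟨-, hd, hdim, hα, hcard⟩ := (isWeilType_iff ιF hF hu).1 h
  obtain ⟨φ₀⟩ : Nonempty (F →+* ℂ) := inferInstance
  let τ₀ : ℚ⟮α⟯ →+* ℂ := φ₀.comp (algebraMap ℚ⟮α⟯ F)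
  have hex := exists_exceptional_of_fibres_balanced ιF hF (algebraMap ℚ⟮α⟯ F) hS
    (fibres_balanced_of_card_eq ιF hF hd hα hdim hcard) (conjugate_ne hd hα τ₀)
  rwa [ncard_fibre_inter_eq ιF hF hd hα hdim hcard τ₀] at hex

include hF in
/-- **`dim Bⁿ(A) − dim Dⁿ(A) ≥ 2` for a simple pair of Weil type `(n, d)`** (the two Weil lines; equality `8 − 6 = 2`
for fourfolds, Gordon 5.13 (ii)). [cite: Gordon1999HodgeAVSurvey, 5.13 (ii) and 9.2.2] [cite: MoonenZarhin1995Duke, Thm. 2.4] -/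
theorem two_le_finrank_hodgeClassSpan_sub_finrank_divisorClassesSpan_of_isWeilType (hS : AbelianVariety.IsSimple A)
    (hu : AbelianVariety.endAlgebra.of A u = ιF α) (h : HodgeTheory.IsWeilType A u n d) :
    2 ≤ Module.finrank ℂ ↥(hodgeClassSpan A.dim A.X n) - Module.finrank ℂ ↥(divisorClassesSpan A.X A.dim n) := by
  obtain ⟨-, hd, hdim, hα, hcard⟩ := (isWeilType_iff ιF hF hu).1 h
  obtain ⟨φ₀⟩ : Nonempty (F →+* ℂ) := inferInstance
  let τ₀ : ℚ⟮α⟯ →+* ℂ := φ₀.comp (algebraMap ℚ⟮α⟯ F)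
  have h2 := two_le_finrank_hodgeClassSpan_sub_finrank_divisorClassesSpan ιF hF (algebraMap ℚ⟮α⟯ F) hS
    (fibres_balanced_of_card_eq ιF hF hd hα hdim hcard) (conjugate_ne hd hα τ₀)
  rwa [ncard_fibre_inter_eq ιF hF hd hα hdim hcard τ₀] at h2

include hF in
/-- **A pair of Weil type has DEGENERATE type** (no simplicity): `Rank(Φ) ≤ dim A` (Yanai, `a = b`, over `ℚ(α)`).
[cite: Gordon1999HodgeAVSurvey, §9.4.3 (Theorem [B.140], Yanai 1994)] [cite: MoonenZarhin1995Duke, (2.7)] -/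
theorem not_isNondegenerate_cmTypeOfPair_of_isWeilType (hu : AbelianVariety.endAlgebra.of A u = ιF α)
    (h : HodgeTheory.IsWeilType A u n d) : ¬ IsNondegenerate (cmTypeOfPair ιF hF) := by
  obtain ⟨-, hd, hdim, hα, hcard⟩ := (isWeilType_iff ιF hF hu).1 h
  obtain ⟨φ₀⟩ : Nonempty (F →+* ℂ) := inferInstance
  exact Pohlmann1968.not_isNondegenerate_of_fibres_balanced (algebraMap ℚ⟮α⟯ F)
    (fibres_balanced_of_card_eq ιF hF hd hα hdim hcard) (conjugate_ne hd hα (φ₀.comp (algebraMap ℚ⟮α⟯ F)))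

include hF in
/-- **A SIMPLE pair of Weil type is not stably nondegenerate** (`B(Aᵐ) ≠ D(Aᵐ)` already for `m = 1`, see
`exists_exceptional_of_isWeilType`; here via Hazama's criterion on the pair). [cite: Gordon1999HodgeAVSurvey, Thm. 6.4 and 5.13 (ii)] -/
theorem not_isStablyNondegenerate_of_isWeilType (hS : AbelianVariety.IsSimple A)
    (hu : AbelianVariety.endAlgebra.of A u = ιF α) (h : HodgeTheory.IsWeilType A u n d) :
    ¬ IsStablyNondegenerate A := fun hst =>
  not_isNondegenerate_cmTypeOfPair_of_isWeilType ιF hF hu h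
    ((isStablyNondegenerate_iff_isNondegenerate_cmTypeOfPair_of_isSimple ιF hF hS).1 hst)

variable [HodgeTensorFacts.{0, 0}] {m : ℕ} (hX : IsSmoothProjective m A.X)

include hF in
/-- **`dim MT(H¹(A)) ≤ dim A` for a pair of Weil type** (no simplicity): the Mumford–Tate rank is `Rank(Φ)` (`mtRank_hodge_one_eq_cmTypeRank`),
which is `≤ dim A + 1` (Kubota) and `≠ dim A + 1` (degenerate). [cite: Gordon1999HodgeAVSurvey, 9.1, 9.4 and §9.4.3]
[cite: MoonenZarhin1995Duke, (2.7)] -/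
theorem mtRank_hodge_one_le_dim_of_isWeilType (hu : AbelianVariety.endAlgebra.of A u = ιF α)
    (h : HodgeTheory.IsWeilType A u n d) :
    haveI := BettiUniverse.finite hX 1
    (BettiUniverse.hodge exists_isReal_hodgeModel_holds hX 1).mtRank ≤ A.dim := by
  haveI := BettiUniverse.finite hX 1
  have hnd := not_isNondegenerate_cmTypeOfPair_of_isWeilType ιF hF hu h
  rw [isNondegenerate_iff] at hnd
  have hle := cmTypeRank_le (cmTypeOfPair ιF hF)
  have hr := mtRank_hodge_one_eq_cmTypeRank ιF hF hX
  omega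

end WeilType

end EndFieldFullDegree

end Literature.AlgebraicGeometry.ComplexMultiplication

end
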